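import Literature.MathematicalPhysics.QuantumLattice.LiebWuMomentumDensityMonotone
import Literature.MathematicalPhysics.QuantumLattice.LiebWuMagnetization
import Literature.MathematicalPhysics.QuantumLattice.LiebWuFillingMonotone
import HarnessLib

/-!
# Lieb–Wu 2003, Theorem 2 (Monotonicity in `B`): `N/N_a` and `M/N` increase with `B`

Family `hubbard`. Lieb–Wu, Physica A 321 (2003) 1, §5. With `G_S = K ∗ (1_S σ_S)` (`= f - t` of eq. (feqn);
`ρ_S(k) = 1/2π + cos k · G_S(sin k)`, eq. (frho)/(13)) increasing in the range `S` (Lemma 2,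
`liebWuG_mono_set` in `LiebWuMomentumDensityMonotone`), this file proves the printed consequences:

* Lemma 2, second sentence: "`ρ(k)` increases for all `|k| ≤ π/2` and decreases for all `π/2 ≤ |k| ≤ π`"
  (`liebWuRhoAtS_mono_set_of_cos_nonneg`, `liebWuRhoAtS_anti_set_of_cos_nonpos`, and the `[-B, B]`
  forms `liebWuRhoAtS_Icc_mono`, `liebWuRhoAtS_Icc_anti`);
* **Theorem 2 (Monotonicity in `B`): "When `B` increases with `Q` fixed, `N/N_a` and `M/N` increase"** —
  `N/N_a = Q/π + ∫_{-sin Q}^{sin Q} G_S` (the printed `∫[Aρ + (1/2π)D]`, by the substitution `x = sin k`;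
  `liebWuFilling_liebWuRhoAtS_eq`), hence `monotone_liebWuFilling_Icc`; and `M/N = ½ - (∫_{|Λ|>B} σ_B)/(2 N/N_a)`
  (eq. (lemma1)) with the tail decreasing (Lemma 1, `tail_antitone`) and `N/N_a` increasing gives
  `monotone_liebWuMagnetisation_Icc`. Together with `LiebWuMagnetization` (`2M < N` for `B < ∞`, `2M = N` at
  `B = ∞`, `M/N → ½`) this is Theorem 2 in full and statement (b) of the 1968 Letter ("monotonically
  increasing in `B` reaching ½ at `B = ∞`"); the `IsLiebWuDensities` forms transfer it to arbitrary solutions;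
* **Lemma 3 (Positivity of `ρ`) for all `B ≤ ∞`** ("owing to the monotonicity in `B` of `f` (Lemma 2) it suffices to
  prove the lemma for `B = ∞`" = `liebWuRhoAt_pos` of `LiebWuFillingMonotone`): `liebWuRhoAtS_pos`; and the
  `B`-independent clauses of **Theorem 3**: `N/N_a = 1` at `Q = π` for all `B` (`liebWuFilling_liebWuRhoAtS_pi`) and
  `N/N_a < 1` for `Q < π`, all `B` (`liebWuFilling_liebWuRhoAtS_lt_one`, via Theorem 2 and the `B = ∞` case
  `liebWuFillingAtCutoff_lt_one`). Not treated here: Lemma 4 / Theorem 3's monotonicity in `Q` at fixed `B < ∞`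
  (the tree has them at `B = ∞`: `liebWuSigmaAt_mono`, `liebWuFillingAtCutoff_strictMonoOn`).

No named fact.

## References

* E. H. Lieb, F. Y. Wu, Physica A 321 (2003) 1–27 = arXiv:cond-mat/0207529, §5, Lemma 2, Theorem 2, Lemma 3,
  Theorem 3, eqs. (frho), (feqn), (density), (lemma1) (key `LiebWuPhysicaA2003`).
* E. H. Lieb, F. Y. Wu, Phys. Rev. Lett. 20 (1968) 1445, statement (b) (key `LiebWuPRL1968`).
-/

noncomputable section

open MeasureTheory Set Real Filter intervalIntegral
open Literature.Analysis.SpecialFunctions Literature.MeasureTheory.Lebesgue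
open scoped Topology

namespace Literature.MathematicalPhysics.QuantumLattice

variable {U Q : ℝ} {S S' : Set ℝ}

/-- An admissible rapidity range (`[-B, B]` or `ℝ`) is measurable. [folklore] -/
private theorem measurableSet_of_range₀ {SΛ : Set ℝ} (h : (∃ B : ℝ, 0 < B ∧ SΛ = Icc (-B) B) ∨ SΛ = univ) :
    MeasurableSet SΛ := by
  rcases h with ⟨B, _, rfl⟩ | rfl
  · exact measurableSet_Icc
  · exact MeasurableSet.univ

section Lemma2Rho

/-- Eq. (frho)/(13): `ρ_S(k) = 1/2π + cos k · G_S(sin k)`. [cite: LiebWuPhysicaA2003, §5, eqs. (frho), (feqn)] -/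
theorem liebWuRhoAtS_eq (U Q : ℝ) (S : Set ℝ) (k : ℝ) :
    liebWuRhoAtS U Q S k = 1 / (2 * π) + Real.cos k * liebWuG U Q S (Real.sin k) := rfl

/-- **Lemma 2 for `ρ`, `cos k ≥ 0`:** `S ⊆ S'` ⇒ `ρ_S(k) ≤ ρ_{S'}(k)`. [cite: LiebWuPhysicaA2003, §5, Lemma 2] -/
theorem liebWuRhoAtS_mono_set_of_cos_nonneg (hU : 0 < U) (hQ : 0 < Q) (hS : MeasurableSet S)
    (hS' : MeasurableSet S') (hSS' : S ⊆ S') {k : ℝ} (hk : 0 ≤ Real.cos k) :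
    liebWuRhoAtS U Q S k ≤ liebWuRhoAtS U Q S' k := by
  rw [liebWuRhoAtS_eq, liebWuRhoAtS_eq]
  exact add_le_add le_rfl (mul_le_mul_of_nonneg_left (liebWuG_mono_set hU hQ hS hS' hSS' _) hk)

/-- **Lemma 2 for `ρ`, `cos k ≤ 0`:** `S ⊆ S'` ⇒ `ρ_{S'}(k) ≤ ρ_S(k)`. [cite: LiebWuPhysicaA2003, §5, Lemma 2] -/
theorem liebWuRhoAtS_anti_set_of_cos_nonpos (hU : 0 < U) (hQ : 0 < Q) (hS : MeasurableSet S)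
    (hS' : MeasurableSet S') (hSS' : S ⊆ S') {k : ℝ} (hk : Real.cos k ≤ 0) :
    liebWuRhoAtS U Q S' k ≤ liebWuRhoAtS U Q S k := by
  rw [liebWuRhoAtS_eq, liebWuRhoAtS_eq]
  exact add_le_add le_rfl (mul_le_mul_of_nonpos_left (liebWuG_mono_set hU hQ hS hS' hSS' _) hk)

/-- **Lemma 2 as printed, `|k| ≤ π/2`:** for `B ≤ B'`, `ρ_B(k) ≤ ρ_{B'}(k)` ("`ρ(k)` increases for all `|k| ≤ π/2`").
[cite: LiebWuPhysicaA2003, §5, Lemma 2] -/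
theorem liebWuRhoAtS_Icc_mono (hU : 0 < U) (hQ : 0 < Q) {B B' : ℝ} (hBB' : B ≤ B') {k : ℝ} (hk : |k| ≤ π / 2) :
    liebWuRhoAtS U Q (Icc (-B) B) k ≤ liebWuRhoAtS U Q (Icc (-B') B') k :=
  liebWuRhoAtS_mono_set_of_cos_nonneg hU hQ measurableSet_Icc measurableSet_Icc
    (Icc_subset_Icc (neg_le_neg hBB') hBB') (Real.cos_nonneg_of_mem_Icc (by constructor <;> linarith [abs_le.1 hk]))

/-- **Lemma 2 as printed, `π/2 ≤ |k| ≤ π`:** for `B ≤ B'`, `ρ_{B'}(k) ≤ ρ_B(k)` ("decreases for all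
`π/2 ≤ |k| ≤ π`"). [cite: LiebWuPhysicaA2003, §5, Lemma 2] -/
theorem liebWuRhoAtS_Icc_anti (hU : 0 < U) (hQ : 0 < Q) {B B' : ℝ} (hBB' : B ≤ B') {k : ℝ} (hk : π / 2 ≤ |k|)
    (hkπ : |k| ≤ π) : liebWuRhoAtS U Q (Icc (-B') B') k ≤ liebWuRhoAtS U Q (Icc (-B) B) k := by
  refine liebWuRhoAtS_anti_set_of_cos_nonpos hU hQ measurableSet_Icc measurableSet_Icc
    (Icc_subset_Icc (neg_le_neg hBB') hBB') ?_
  rw [← Real.cos_abs]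
  exact Real.cos_nonpos_of_pi_div_two_le_of_le hk (by linarith [Real.pi_pos])

/-- Lemma 2 for `ρ` at `B = ∞` versus `B < ∞`, `|k| ≤ π/2`. [cite: LiebWuPhysicaA2003, §5, Lemma 2] -/
theorem liebWuRhoAtS_Icc_le_univ (hU : 0 < U) (hQ : 0 < Q) (B : ℝ) {k : ℝ} (hk : |k| ≤ π / 2) :
    liebWuRhoAtS U Q (Icc (-B) B) k ≤ liebWuRhoAtS U Q univ k :=
  liebWuRhoAtS_mono_set_of_cos_nonneg hU hQ measurableSet_Icc MeasurableSet.univ (subset_univ _)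
    (Real.cos_nonneg_of_mem_Icc (by constructor <;> linarith [abs_le.1 hk]))

end Lemma2Rho

section Theorem2

/-- **`N/N_a = ∫[Aρ + (1/2π)D] = Q/π + ∫_{-sin Q}^{sin Q} G_S`** (substitute `x = sin k` in
`∫_{-Q}^{Q} cos k · G_S(sin k) dk`). [cite: LiebWuPhysicaA2003, §5, proof of Theorem 2] -/
theorem liebWuFilling_liebWuRhoAtS_eq (hU : 0 < U) (hQ : 0 < Q) (hS : MeasurableSet S) :
    liebWuFilling Q (liebWuRhoAtS U Q S) = Q / π + ∫ x in -Real.sin Q..Real.sin Q, liebWuG U Q S x := by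
  have hGc : Continuous (liebWuG U Q S) := (liebWuG_props hU hQ hS).1
  have hsub : ∫ k in -Q..Q, Real.cos k * liebWuG U Q S (Real.sin k) =
      ∫ x in -Real.sin Q..Real.sin Q, liebWuG U Q S x := by
    rw [← Real.sin_neg, ← intervalIntegral.integral_comp_mul_deriv (fun k _ => Real.hasDerivAt_sin k)
      Real.continuous_cos.continuousOn hGc]
    exact intervalIntegral.integral_congr fun k _ => by simp only [Function.comp_apply]; ring
  have hi1 : IntervalIntegrable (fun _ : ℝ => 1 / (2 * π)) volume (-Q) Q := intervalIntegrable_const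
  have hi2 : IntervalIntegrable (fun k => Real.cos k * liebWuG U Q S (Real.sin k)) volume (-Q) Q :=
    (Real.continuous_cos.mul (hGc.comp Real.continuous_sin)).intervalIntegrable _ _
  have h : liebWuFilling Q (liebWuRhoAtS U Q S) =
      ∫ k in -Q..Q, (1 / (2 * π) + Real.cos k * liebWuG U Q S (Real.sin k)) := rfl
  rw [h, intervalIntegral.integral_add hi1 hi2, intervalIntegral.integral_const, hsub, smul_eq_mul]
  congr 1
  field_simp
  ring

/-- **Theorem 2, `N/N_a` increases with the range:** `S ⊆ S'` ⇒ `N/N_a(S) ≤ N/N_a(S')` (`0 < Q ≤ π`).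
[cite: LiebWuPhysicaA2003, §5, Theorem 2] -/
theorem liebWuFilling_liebWuRhoAtS_mono_set (hU : 0 < U) (hQ : 0 < Q) (hQπ : Q ≤ π) (hS : MeasurableSet S)
    (hS' : MeasurableSet S') (hSS' : S ⊆ S') :
    liebWuFilling Q (liebWuRhoAtS U Q S) ≤ liebWuFilling Q (liebWuRhoAtS U Q S') := by
  have ha : 0 ≤ Real.sin Q := Real.sin_nonneg_of_nonneg_of_le_pi hQ.le hQπ
  rw [liebWuFilling_liebWuRhoAtS_eq hU hQ hS, liebWuFilling_liebWuRhoAtS_eq hU hQ hS']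
  exact add_le_add le_rfl (intervalIntegral.integral_mono_on (by linarith)
    ((liebWuG_props hU hQ hS).1.intervalIntegrable _ _) ((liebWuG_props hU hQ hS').1.intervalIntegrable _ _)
    fun x _ => liebWuG_mono_set hU hQ hS hS' hSS' x)

/-- **Theorem 2 (Monotonicity in `B`), `N/N_a`:** "When `B` increases with `Q` fixed, `N/N_a` increases."
[cite: LiebWuPhysicaA2003, §5, Theorem 2] -/
theorem monotone_liebWuFilling_Icc (hU : 0 < U) (hQ : 0 < Q) (hQπ : Q ≤ π) :
    Monotone fun B : ℝ => liebWuFilling Q (liebWuRhoAtS U Q (Icc (-B) B)) := fun _ _ hBB' =>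
  liebWuFilling_liebWuRhoAtS_mono_set hU hQ hQπ measurableSet_Icc measurableSet_Icc
    (Icc_subset_Icc (neg_le_neg hBB') hBB')

/-- `N/N_a` at `B < ∞` is at most its value at `B = ∞`. [cite: LiebWuPhysicaA2003, §5, Theorem 2] -/
theorem liebWuFilling_Icc_le_univ (hU : 0 < U) (hQ : 0 < Q) (hQπ : Q ≤ π) (B : ℝ) :
    liebWuFilling Q (liebWuRhoAtS U Q (Icc (-B) B)) ≤ liebWuFilling Q (liebWuRhoAtS U Q univ) :=
  liebWuFilling_liebWuRhoAtS_mono_set hU hQ hQπ measurableSet_Icc MeasurableSet.univ (subset_univ _)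

/-- **Theorem 2 (Monotonicity in `B`), `M/N`:** "When `B` increases with `Q` fixed, `M/N` increases"
(`M/N = ½ - (∫_{|Λ|>B} σ_B)/(2 N/N_a)` by (lemma1); the tail decreases by Lemma 1 and `N/N_a` increases).
[cite: LiebWuPhysicaA2003, §5, Theorem 2] -/
theorem monotone_liebWuMagnetisation_Icc (hU : 0 < U) (hQ : 0 < Q) (hQπ : Q ≤ π) :
    Monotone fun B : ℝ => liebWuDownSpinDensity (Icc (-B) B) (liebWuSigmaAtS U Q (Icc (-B) B)) /
      liebWuFilling Q (liebWuRhoAtS U Q (Icc (-B) B)) := by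
  intro B B' hBB'
  have hq : 0 < Q / (2 * π) := by positivity
  have hn := liebWuFilling_liebWuRhoAtS_ge hU hQ hQπ (measurableSet_Icc : MeasurableSet (Icc (-B) B))
  have hn' := liebWuFilling_liebWuRhoAtS_ge hU hQ hQπ (measurableSet_Icc : MeasurableSet (Icc (-B') B'))
  have hnn' := monotone_liebWuFilling_Icc hU hQ hQπ hBB'
  have hτ := tail_antitone hU hQ hBB'
  have hτ'0 : 0 ≤ ∫ Λ in (Icc (-B') B')ᶜ, liebWuSigmaAtS U Q (Icc (-B') B') Λ :=
    setIntegral_nonneg measurableSet_Icc.compl fun t _ => (liebWuSigmaAtS_pos hU hQ measurableSet_Icc t).le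
  have hid := two_mul_downSpin_add_tail (S := Icc (-B) B) hU hQ hQπ measurableSet_Icc
  have hid' := two_mul_downSpin_add_tail (S := Icc (-B') B') hU hQ hQπ measurableSet_Icc
  dsimp only at hnn' ⊢
  rw [div_le_div_iff₀ (hq.trans_le hn) (hq.trans_le hn')]
  nlinarith

/-- `M/N` at `B < ∞` is below its value `½` at `B = ∞`. [cite: LiebWuPhysicaA2003, §5, Theorem 2] -/
theorem liebWuMagnetisation_Icc_lt_univ (hU : 0 < U) (hQ : 0 < Q) (hQπ : Q ≤ π) (B : ℝ) :
    liebWuDownSpinDensity (Icc (-B) B) (liebWuSigmaAtS U Q (Icc (-B) B)) /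
        liebWuFilling Q (liebWuRhoAtS U Q (Icc (-B) B)) <
      liebWuDownSpinDensity univ (liebWuSigmaAtS U Q univ) / liebWuFilling Q (liebWuRhoAtS U Q univ) := by
  have hq : 0 < Q / (2 * π) := by positivity
  have hn := hq.trans_le (liebWuFilling_liebWuRhoAtS_ge hU hQ hQπ (measurableSet_Icc : MeasurableSet (Icc (-B) B)))
  have hn' := hq.trans_le (liebWuFilling_liebWuRhoAtS_ge hU hQ hQπ MeasurableSet.univ)
  have h1 : liebWuDownSpinDensity univ (liebWuSigmaAtS U Q univ) / liebWuFilling Q (liebWuRhoAtS U Q univ) = 1 / 2 := by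
    rw [div_eq_iff hn'.ne', ← two_mul_downSpin_eq_filling_univ hU hQ hQπ]; ring
  rw [h1, div_lt_iff₀ hn]
  linarith [two_mul_downSpin_lt_filling_Icc hU hQ hQπ B]

end Theorem2

section Lemma3Theorem3

/-- **Lemma 3 (Positivity of `ρ`) for all `B ≤ ∞`:** `ρ_S(k) > 0` for every measurable range `S`, `0 < Q ≤ π` and
all `k` ("owing to the monotonicity in `B` of `f` (Lemma 2) it suffices to prove the lemma for `B = ∞`", which is
`liebWuRhoAt_pos`). [cite: LiebWuPhysicaA2003, §5, Lemma 3] -/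
theorem liebWuRhoAtS_pos (hU : 0 < U) (hQ : 0 < Q) (hQπ : Q ≤ π) (hS : MeasurableSet S) (k : ℝ) :
    0 < liebWuRhoAtS U Q S k := by
  rcases le_total 0 (Real.cos k) with hk | hk
  · rw [liebWuRhoAtS_eq]
    exact add_pos_of_pos_of_nonneg (by positivity) (mul_nonneg hk ((liebWuG_props hU hQ hS).2.1 _))
  · calc 0 < liebWuRhoAt U Q k := liebWuRhoAt_pos hU hQ hQπ k
      _ = liebWuRhoAtS U Q univ k := by rw [liebWuRhoAtS_univ]
      _ ≤ liebWuRhoAtS U Q S k :=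
        liebWuRhoAtS_anti_set_of_cos_nonpos hU hQ hS MeasurableSet.univ (subset_univ _) hk

/-- **Theorem 3, "when `Q = π`, `N/N_a = 1` (for all `B`)".** [cite: LiebWuPhysicaA2003, §5, Theorem 3] -/
theorem liebWuFilling_liebWuRhoAtS_pi (hU : 0 < U) (hS : MeasurableSet S) :
    liebWuFilling π (liebWuRhoAtS U π S) = 1 := by
  rw [liebWuFilling_liebWuRhoAtS_eq hU Real.pi_pos hS, Real.sin_pi, neg_zero, intervalIntegral.integral_same,
    add_zero, div_self Real.pi_pos.ne']

/-- **Theorem 3, "`N/N_a < 1` if `Q < π`", for all `B`** (here: `N/N_a(S) ≤ N/N_a(ℝ)` by Theorem 2 and the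
`B = ∞` case `liebWuFillingAtCutoff_lt_one`; the printed proof bounds by `σ` at `B = ∞`, `Q = π` likewise).
[cite: LiebWuPhysicaA2003, §5, Theorem 3] -/
theorem liebWuFilling_liebWuRhoAtS_lt_one (hU : 0 < U) (hQ : 0 < Q) (hQπ : Q < π) (hS : MeasurableSet S) :
    liebWuFilling Q (liebWuRhoAtS U Q S) < 1 :=
  calc liebWuFilling Q (liebWuRhoAtS U Q S) ≤ liebWuFilling Q (liebWuRhoAtS U Q univ) :=
        liebWuFilling_liebWuRhoAtS_mono_set hU hQ hQπ.le hS MeasurableSet.univ (subset_univ _)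
    _ = liebWuFillingAtCutoff U Q := by rw [liebWuRhoAtS_univ]; rfl
    _ < 1 := liebWuFillingAtCutoff_lt_one hU hQ hQπ

end Lemma3Theorem3

section Solutions

variable {SΛ₁ SΛ₂ : Set ℝ} {ρ₁ σ₁ ρ₂ σ₂ : ℝ → ℝ}

/-- **Theorem 2 for arbitrary solutions, `N/N_a`:** if `(ρ₁, σ₁)`, `(ρ₂, σ₂)` solve the Lieb–Wu equations at
the same `U, Q` with ranges `SΛ₁ ⊆ SΛ₂`, then `N/N_a(ρ₁) ≤ N/N_a(ρ₂)`. [cite: LiebWuPhysicaA2003, §5, Theorem 2] -/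
theorem IsLiebWuDensities.filling_mono (hU : 0 < U) (h₁ : IsLiebWuDensities U Q SΛ₁ ρ₁ σ₁)
    (h₂ : IsLiebWuDensities U Q SΛ₂ ρ₂ σ₂) (hsub : SΛ₁ ⊆ SΛ₂) : liebWuFilling Q ρ₁ ≤ liebWuFilling Q ρ₂ := by
  have hS₁ := measurableSet_of_range₀ h₁.range_eq
  have hS₂ := measurableSet_of_range₀ h₂.range_eq
  obtain ⟨hf₁, -, -⟩ := IsLiebWuDensities.functionals_unique_on hU hS₁ h₁
    (isLiebWuDensities_liebWuRhoAtS_of_range hU h₁.cutoff_pos h₁.cutoff_le_pi h₁.range_eq)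
  obtain ⟨hf₂, -, -⟩ := IsLiebWuDensities.functionals_unique_on hU hS₂ h₂
    (isLiebWuDensities_liebWuRhoAtS_of_range hU h₂.cutoff_pos h₂.cutoff_le_pi h₂.range_eq)
  rw [hf₁, hf₂]
  exact liebWuFilling_liebWuRhoAtS_mono_set hU h₁.cutoff_pos h₁.cutoff_le_pi hS₁ hS₂ hsub

/-- **Lemma 2 for arbitrary solutions:** with ranges `SΛ₁ ⊆ SΛ₂`, `ρ₁(k) ≤ ρ₂(k)` for `|k| ≤ Q`, `|k| ≤ π/2`.
[cite: LiebWuPhysicaA2003, §5, Lemma 2] -/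
theorem IsLiebWuDensities.rho_mono (hU : 0 < U) (h₁ : IsLiebWuDensities U Q SΛ₁ ρ₁ σ₁)
    (h₂ : IsLiebWuDensities U Q SΛ₂ ρ₂ σ₂) (hsub : SΛ₁ ⊆ SΛ₂) {k : ℝ} (hkQ : k ∈ Icc (-Q) Q)
    (hk : |k| ≤ π / 2) : ρ₁ k ≤ ρ₂ k := by
  rw [(h₁.eq_neumann_of_range hU).2 k hkQ, (h₂.eq_neumann_of_range hU).2 k hkQ]
  exact liebWuRhoAtS_mono_set_of_cos_nonneg hU h₁.cutoff_pos (measurableSet_of_range₀ h₁.range_eq)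
    (measurableSet_of_range₀ h₂.range_eq) hsub (Real.cos_nonneg_of_mem_Icc (by constructor <;> linarith [abs_le.1 hk]))

/-- **Theorem 2 for arbitrary solutions, `M/N` (statement (b) of the Letter: "monotonically increasing
in `B`"):** with ranges `[-B₁, B₁] ⊆ [-B₂, B₂]`, `M/N(1) ≤ M/N(2)`. [cite: LiebWuPRL1968, statement (b)] -/
theorem IsLiebWuDensities.magnetisation_mono (hU : 0 < U) {B₁ B₂ : ℝ} (hB : B₁ ≤ B₂)
    (h₁ : IsLiebWuDensities U Q (Icc (-B₁) B₁) ρ₁ σ₁) (h₂ : IsLiebWuDensities U Q (Icc (-B₂) B₂) ρ₂ σ₂) :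
    liebWuDownSpinDensity (Icc (-B₁) B₁) σ₁ / liebWuFilling Q ρ₁ ≤
      liebWuDownSpinDensity (Icc (-B₂) B₂) σ₂ / liebWuFilling Q ρ₂ := by
  have hQ := h₁.cutoff_pos
  have hQπ := h₁.cutoff_le_pi
  obtain ⟨hf₁, -, hd₁⟩ := IsLiebWuDensities.functionals_unique_on hU measurableSet_Icc h₁
    (isLiebWuDensities_liebWuRhoAtS_of_range hU hQ hQπ h₁.range_eq)
  obtain ⟨hf₂, -, hd₂⟩ := IsLiebWuDensities.functionals_unique_on hU measurableSet_Icc h₂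
    (isLiebWuDensities_liebWuRhoAtS_of_range hU hQ hQπ h₂.range_eq)
  rw [hf₁, hf₂, hd₁, hd₂]
  exact monotone_liebWuMagnetisation_Icc hU hQ hQπ hB

/-- **Lemma 3 for an arbitrary solution:** `ρ > 0` on `[-Q, Q]`, for every admissible range.
[cite: LiebWuPhysicaA2003, §5, Lemma 3] -/
theorem IsLiebWuDensities.rho_pos_on (hU : 0 < U) (h₁ : IsLiebWuDensities U Q SΛ₁ ρ₁ σ₁) {k : ℝ}
    (hk : k ∈ Icc (-Q) Q) : 0 < ρ₁ k := by
  rw [(h₁.eq_neumann_of_range hU).2 k hk]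
  exact liebWuRhoAtS_pos hU h₁.cutoff_pos h₁.cutoff_le_pi (measurableSet_of_range₀ h₁.range_eq) k

/-- **Theorem 3 for an arbitrary solution:** `N/N_a = 1` if `Q = π` and `N/N_a < 1` if `Q < π` (any range).
[cite: LiebWuPhysicaA2003, §5, Theorem 3] -/
theorem IsLiebWuDensities.filling_eq_one_or_lt_one (hU : 0 < U) (h₁ : IsLiebWuDensities U Q SΛ₁ ρ₁ σ₁) :
    (Q = π → liebWuFilling Q ρ₁ = 1) ∧ (Q < π → liebWuFilling Q ρ₁ < 1) := by
  have hS₁ := measurableSet_of_range₀ h₁.range_eq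
  obtain ⟨hf₁, -, -⟩ := IsLiebWuDensities.functionals_unique_on hU hS₁ h₁
    (isLiebWuDensities_liebWuRhoAtS_of_range hU h₁.cutoff_pos h₁.cutoff_le_pi h₁.range_eq)
  rw [hf₁]
  refine ⟨fun hQ => ?_, fun hQ => liebWuFilling_liebWuRhoAtS_lt_one hU h₁.cutoff_pos hQ hS₁⟩
  subst hQ
  exact liebWuFilling_liebWuRhoAtS_pi hU hS₁

end Solutions

end Literature.MathematicalPhysics.QuantumLattice

end
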